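import Summits.BirchSwinnertonDyer.BirchSwinnertonDyer.Theorems.BiquadraticEisensteinDescentManinDatumSupercuspidalCMInertSevenDivisionEisenstein
import Summits.BirchSwinnertonDyer.BirchSwinnertonDyer.Theorems.InertBadSignedBranchesInertBadAtThreeQuarticTorsionCoordinates
import Literature.NumberTheory.EllipticCurves.WeierstrassAdditionProofs
import HarnessLib

set_option linter.dupNamespace false -- `Summit.BirchSwinnertonDyer.BirchSwinnertonDyer.Theorems.…` (summit = sub, D-0017)
set_option autoImplicit false

/-!
# Crux `ManinDatumSupercuspidalCMInert` (stmt-BirchSwinnertonDyer-20111, BED r605), CM side of H₇ — step (b) of memo PLAIN-ODD-57 §3/§5: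
# the chord through a `7`-integral torsion point and a `7`-division point of `y² = x³ − x` lands on a `7`-integral point
# congruent to the first (valued-field algebra + the analytic addition theorem on the Gaussian lattice)

Route `BiquadraticEisensteinDescent` (cell `pub/bsd-wall`, width seat `bsd-wall-cm-bed-w4` g10, RESOLVENT LANE; `--supports`
stmt-BirchSwinnertonDyer-20111, helper). THEOREMS ONLY (no definition, no named fact, no `sorry`); nothing is closed by this file and BSD is not
proved by any of it. Sequel to `…TameResolvent` (step (e)) and `…SevenDivisionEisenstein` (step (c)).

In memo §3 the smoothed Eisenstein value at `P_w + Q_t` (`P_w` of order prime to `7`, `Q_t` a `7`-division point) is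
`y = −½·Y(P_w+Q_t)·Σ_v 1/(X(P_w+Q_t) − X(v))`; the resolvent count needs `y` to be `7`-INTEGRAL. This file proves the point-level input:

* `val_le_one_of_isIntegral`, `val_natCast_eq_one_of_coprime_seven` — generalities: algebraic integers have `v ≤ 1`; `v ℓ = 1` for
  `7 ∤ ℓ` once `v 7 < 1` (Bézout);
* `val_sq_Y_formal`, ★ `chord_formal`, `chord_formal_sub_unit` — VALUED-FIELD ALGEBRA on an integral model `y² = x³ + Ax + B`: if
  `v X_P, v Y_P ≤ 1` and `Q` is «in the formal group» (`v X_Q > 1`), then `v(Y_Q)² = v(X_Q)³`, the chord abscissa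
  `X₊ = λ² − X_P − X_Q` (`λ = (Y_Q − Y_P)/(X_Q − X_P)`) has `v(X₊ − X_P) < 1`, and `v(X₊ − X_v) = 1` whenever `v(X_P − X_v) = 1`;
* `normalizedX_add` — the analytic addition theorem of the tree (`PeriodPair.weierstrassP_add_holds`, Armitage–Eberlein (7.68)) in the
  normalised coordinates `X = ℘/ϖ₀²`, `Y = ℘′/(2ϖ₀³)` of `y² = x³ − x`: `X(u + t) = ((Y_u − Y_t)/(X_u − X_t))² − X_u − X_t`;
* `val_normalizedX_le_one_of_torsion` — a point `w` of order `m′` prime to `7` has `7`-integral `X`, `Y` (tree `torsion_coord_isIntegral`: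
  `m′²X, m′³Y ∈ ℤ̄`, and `m′` is a `v`-unit);
* ★ `val_normalizedX_add_seven_div` — for `w` of order prime to `7`, `t` a `7`-division point and EVERY valuation `v` of `ℂ` with `v 7 < 1`:
  `v(X(w+t) − X(w)) < 1`, `v(X(w+t)) ≤ 1`, `v(Y(w+t)) ≤ 1`.

What remains of memo §5 (b) after this file: «`v(X_w − X_u) = 1` for distinct prime-to-`7` torsion classes `w ≢ ±u`» (then
`chord_formal_sub_unit` gives the unit denominators), and step (d). References: [SilvermanAEC2009] III.2.3 (chord), VII.3 (formal group:
`v(x) < 0` there), Prop. VI.3.6; [ArmitageEberlein2001] §7.4.2 Thm 7.2 (7.68).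
-/

noncomputable section

open Polynomial Complex

namespace Summit.BirchSwinnertonDyer.BirchSwinnertonDyer.Theorems.BiquadraticEisensteinDescentManinDatumSupercuspidalCMInertFormalChord

open Summit.BirchSwinnertonDyer.BirchSwinnertonDyer.Theorems.BiquadraticEisensteinDescentManinDatumSupercuspidalCMInertSevenDivisionEisenstein
  (val_intCast_le_one val_weierstrassP_seven_div)

/-! ## §1 Valued-field algebra -/

section Valued

variable {F Γ₀ : Type*} [Field F] [LinearOrderedCommGroupWithZero Γ₀] (v : Valuation F Γ₀)

/-- **Algebraic integers are `v`-integral** for every valuation: a root of a monic polynomial with `ℤ`-coefficients has `v ≤ 1`.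
[folklore] -/
theorem val_le_one_of_isIntegral {z : F} (hz : IsIntegral ℤ z) : v z ≤ 1 := by
  obtain ⟨p, hp, hpz⟩ := hz
  by_contra hlt
  push Not at hlt
  have hz0 : 0 < v z := lt_trans zero_lt_one hlt
  -- `z^n = -(Σ_{i<n} c_i z^i)` with `v (c_i z^i) < v z ^ n`
  have heval : z ^ p.natDegree = -∑ i ∈ Finset.range p.natDegree, (p.coeff i : F) * z ^ i := by
    have h := hpz
    rw [hp.as_sum, Polynomial.eval₂_add, Polynomial.eval₂_pow, Polynomial.eval₂_X,
      Polynomial.eval₂_finsetSum] at h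
    simp only [Polynomial.eval₂_mul, Polynomial.eval₂_C, Polynomial.eval₂_pow, Polynomial.eval₂_X] at h
    simp only [eq_intCast] at h
    linear_combination h
  have hlt' : v (∑ i ∈ Finset.range p.natDegree, (p.coeff i : F) * z ^ i) < v z ^ p.natDegree := by
    refine Valuation.map_sum_lt v (pow_ne_zero _ hz0.ne') fun i hi ↦ ?_
    rw [Finset.mem_range] at hi
    rw [Valuation.map_mul, Valuation.map_pow]
    calc v (p.coeff i : F) * v z ^ i ≤ 1 * v z ^ i := mul_le_mul' (val_intCast_le_one v _) le_rfl
      _ = v z ^ i := one_mul _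
      _ < v z ^ p.natDegree := pow_lt_pow_right₀ hlt hi
  have := congrArg v heval
  rw [Valuation.map_pow, Valuation.map_neg] at this
  exact absurd this (ne_of_gt hlt')

/-- **`v ℓ = 1` for `7 ∤ ℓ` once `v 7 < 1`** (Bézout: `1 = a·7 + b·ℓ`). [folklore] -/
theorem val_natCast_eq_one_of_coprime_seven (h7 : v 7 < 1) {ℓ : ℕ} (hℓ : Nat.Coprime ℓ 7) : v (ℓ : F) = 1 := by
  refine le_antisymm (by exact_mod_cast val_intCast_le_one v ℓ) ?_
  by_contra hlt
  push Not at hlt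
  obtain ⟨a, b, hab⟩ := (Nat.isCoprime_iff_coprime.mpr hℓ)
  have h1 : (1 : F) = (a : F) * ℓ + (b : F) * 7 := by
    have h := congrArg (Int.cast (R := F)) hab
    push_cast at h
    exact h.symm
  have : v (1 : F) < 1 := by
    rw [h1]
    refine Valuation.map_add_lt v ?_ ?_
    · rw [Valuation.map_mul]
      calc v (a : F) * v (ℓ : F) ≤ 1 * v (ℓ : F) := mul_le_mul' (val_intCast_le_one v a) le_rfl
        _ = v (ℓ : F) := one_mul _
        _ < 1 := hlt
    · rw [Valuation.map_mul]
      calc v (b : F) * v 7 ≤ 1 * v 7 := mul_le_mul' (val_intCast_le_one v b) le_rfl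
        _ = v 7 := one_mul _
        _ < 1 := h7
  rw [Valuation.map_one] at this
  exact lt_irrefl _ this

/-- Natural numbers have valuation `≤ 1`. [folklore] -/
theorem val_natCast_le_one (n : ℕ) : v (n : F) ≤ 1 := by
  exact_mod_cast val_intCast_le_one v n

/-- **A point of the formal group: `v(Y_Q)² = v(X_Q)³`.** On an integral model `y² = x³ + Ax + B` (`v A, v B ≤ 1`), a point with
`v X_Q > 1` has `v(Y_Q)² = v(X_Q)³`. [cite: SilvermanAEC2009, VII.3 (points with `v(x) < 0`)] -/
theorem val_sq_Y_formal {A B XQ YQ : F} (hA : v A ≤ 1) (hB : v B ≤ 1) (hQ : YQ ^ 2 = XQ ^ 3 + A * XQ + B)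
    (hq : 1 < v XQ) : v YQ ^ 2 = v XQ ^ 3 := by
  have hlow : v (A * XQ + B) < v (XQ ^ 3) := by
    rw [Valuation.map_pow]
    refine lt_of_le_of_lt (Valuation.map_add v _ _) (max_lt ?_ ?_)
    · rw [Valuation.map_mul]
      calc v A * v XQ ≤ 1 * v XQ := mul_le_mul_left hA _
        _ = v XQ ^ 1 := by rw [one_mul, pow_one]
        _ < v XQ ^ 3 := pow_lt_pow_right₀ hq (by norm_num)
    · exact lt_of_le_of_lt hB (one_lt_pow₀ hq (by norm_num))
  rw [← Valuation.map_pow, hQ, add_assoc, Valuation.map_add_eq_of_lt_left v hlow, Valuation.map_pow]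

/-- ★ **The chord through an integral point and a formal-group point.** On an integral model `y² = x³ + Ax + B` in a valued field: if
`v X_P, v Y_P ≤ 1` and `Y_Q² = X_Q³ + AX_Q + B` with `v X_Q > 1`, then the abscissa `X₊ = λ² − X_P − X_Q`, `λ = (Y_Q − Y_P)/(X_Q − X_P)`, of
the third intersection point satisfies `v(X₊ − X_P) < 1` (so `X₊` is integral and `≡ X_P`), and `v(λ·(X₊ − X_P)) ≤ 1`.
(`X₊ − X_P = N/(X_Q − X_P)²` with `N = AX_Q + B − 2Y_QY_P + Y_P² + 3X_QX_P² − 2X_P³`, `v N ≤ max(v X_Q, v Y_Q) < v(X_Q)²`.)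
[cite: SilvermanAEC2009, III.2.3 (group law) and VII.2] -/
theorem chord_formal {A B XP YP XQ YQ : F} (hA : v A ≤ 1) (hB : v B ≤ 1) (hXP : v XP ≤ 1) (hYP : v YP ≤ 1)
    (hQ : YQ ^ 2 = XQ ^ 3 + A * XQ + B) (hq : 1 < v XQ) :
    v (((YQ - YP) / (XQ - XP)) ^ 2 - XP - XQ - XP) < 1 ∧
      v ((YQ - YP) / (XQ - XP) * (((YQ - YP) / (XQ - XP)) ^ 2 - XP - XQ - XP)) ≤ 1 := by
  set q := v XQ with hqdef
  have hq1 : (1 : Γ₀) ≤ q := hq.le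
  have hqpos : 0 < q := lt_trans zero_lt_one hq
  have hq0 : q ≠ 0 := ne_of_gt hqpos
  have hY2 : v YQ ^ 2 = q ^ 3 := val_sq_Y_formal v hA hB hQ hq
  -- `v (X_Q − X_P) = q`
  have hD : v (XQ - XP) = q := by
    rw [sub_eq_add_neg, Valuation.map_add_eq_of_lt_left v (by rw [Valuation.map_neg]; exact lt_of_le_of_lt hXP hq)]
  have hD0 : XQ - XP ≠ 0 := fun h ↦ hq0 (by rw [← hD, h, Valuation.map_zero])
  -- the numerator `N` of `X₊ − X_P`
  set N : F := A * XQ + B - 2 * YQ * YP + YP ^ 2 + 3 * XQ * XP ^ 2 - 2 * XP ^ 3 with hNdef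
  have hN : ((YQ - YP) / (XQ - XP)) ^ 2 - XP - XQ - XP = N / (XQ - XP) ^ 2 := by
    rw [hNdef]
    field_simp
    linear_combination hQ
  have h2 : v (2 : F) ≤ 1 := by exact_mod_cast val_natCast_le_one v 2
  have h3 : v (3 : F) ≤ 1 := by exact_mod_cast val_natCast_le_one v 3
  -- `v N ≤ g := max q (v YQ)`
  set g : Γ₀ := max q (v YQ) with hgdef
  have hqg : q ≤ g := le_max_left _ _
  have h1g : (1 : Γ₀) ≤ g := hq1.trans hqg
  have hvN : v N ≤ g := by
    rw [hNdef]
    refine Valuation.map_sub_le v (Valuation.map_add_le v (Valuation.map_add_le v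
      (Valuation.map_sub_le v (Valuation.map_add_le v ?_ (hB.trans h1g)) ?_) ?_) ?_) ?_
    · rw [Valuation.map_mul]
      calc v A * q ≤ 1 * q := mul_le_mul_left hA _
        _ = q := one_mul _
        _ ≤ g := hqg
    · rw [Valuation.map_mul, Valuation.map_mul]
      calc v 2 * v YQ * v YP ≤ 1 * v YQ * 1 := mul_le_mul' (mul_le_mul' h2 le_rfl) hYP
        _ = v YQ := by rw [one_mul, mul_one]
        _ ≤ g := le_max_right _ _
    · rw [Valuation.map_pow]
      exact (pow_le_one₀ zero_le hYP).trans h1g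
    · rw [Valuation.map_mul, Valuation.map_mul, Valuation.map_pow]
      calc v 3 * q * v XP ^ 2 ≤ 1 * q * 1 := mul_le_mul' (mul_le_mul' h3 le_rfl) (pow_le_one₀ zero_le hXP)
        _ = q := by rw [one_mul, mul_one]
        _ ≤ g := hqg
    · rw [Valuation.map_mul, Valuation.map_pow]
      calc v 2 * v XP ^ 3 ≤ 1 * 1 := mul_le_mul' h2 (pow_le_one₀ zero_le hXP)
        _ = 1 := one_mul 1
        _ ≤ g := h1g
  -- `g < q²`
  have hYlt : v YQ < q ^ 2 := by
    have : v YQ ^ 2 < (q ^ 2) ^ 2 := by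
      rw [hY2, ← pow_mul]
      exact pow_lt_pow_right₀ hq (by norm_num)
    exact lt_of_pow_lt_pow_left₀ 2 zero_le this
  have hglt : g < q ^ 2 := by
    refine max_lt ?_ hYlt
    calc q = q ^ 1 := (pow_one q).symm
      _ < q ^ 2 := pow_lt_pow_right₀ hq (by norm_num)
  have hX : v (((YQ - YP) / (XQ - XP)) ^ 2 - XP - XQ - XP) < 1 := by
    rw [hN, map_div₀, Valuation.map_pow, hD, div_lt_one₀ (pow_pos hqpos 2)]
    exact lt_of_le_of_lt hvN hglt
  refine ⟨hX, ?_⟩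
  -- `v λ · v (X₊ − X_P) ≤ 1`: `v (YQ − YP) · v N ≤ q³ = q · q²`
  rw [Valuation.map_mul, hN, map_div₀, map_div₀, Valuation.map_pow, hD]
  have hnum : v (YQ - YP) * v N ≤ q * q ^ 2 := by
    rcases le_total q (v YQ) with hle | hle
    · have h1 : v (YQ - YP) ≤ v YQ := Valuation.map_sub_le v le_rfl (hYP.trans (hq1.trans hle))
      have h2' : v N ≤ v YQ := hvN.trans (max_le hle le_rfl)
      calc v (YQ - YP) * v N ≤ v YQ * v YQ := mul_le_mul' h1 h2'
        _ = q ^ 3 := by rw [← sq, hY2]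
        _ = q * q ^ 2 := pow_succ' q 2
    · have h1 : v (YQ - YP) ≤ q := Valuation.map_sub_le v hle (hYP.trans hq1)
      have h2' : v N ≤ q := hvN.trans (max_le le_rfl hle)
      calc v (YQ - YP) * v N ≤ q * q := mul_le_mul' h1 h2'
        _ ≤ q * q ^ 2 := by
          refine mul_le_mul' le_rfl ?_
          calc q = q ^ 1 := (pow_one q).symm
            _ ≤ q ^ 2 := pow_le_pow_right₀ hq1 (by norm_num)
  rw [div_mul_div_comm, div_le_one₀ (mul_pos hqpos (pow_pos hqpos 2))]
  exact hnum

/-- The chord abscissa is a unit away from every `X_v` that is a unit away from `X_P`. [folklore] -/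
theorem chord_formal_sub_unit {A B XP YP XQ YQ Xv : F} (hA : v A ≤ 1) (hB : v B ≤ 1) (hXP : v XP ≤ 1) (hYP : v YP ≤ 1)
    (hQ : YQ ^ 2 = XQ ^ 3 + A * XQ + B) (hq : 1 < v XQ) (hv : v (XP - Xv) = 1) :
    v ((((YQ - YP) / (XQ - XP)) ^ 2 - XP - XQ) - Xv) = 1 := by
  have h := (chord_formal v hA hB hXP hYP hQ hq).1
  have : ((YQ - YP) / (XQ - XP)) ^ 2 - XP - XQ - Xv = (((YQ - YP) / (XQ - XP)) ^ 2 - XP - XQ - XP) + (XP - Xv) := by ring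
  rw [this, add_comm, Valuation.map_add_eq_of_lt_left v (by rw [hv]; exact h), hv]

end Valued

/-! ## §2 The Gaussian lattice: normalised addition theorem and `7`-integrality at `P_w + Q_t` -/

section Analytic

open scoped PeriodPair
open PeriodPair Literature.NumberTheory.EllipticCurves Literature.NumberTheory.EllipticCurves.GaussianLattice
open Summit.BirchSwinnertonDyer.BirchSwinnertonDyer.Theorems.InertBadSignedBranchesInertBadAtThreeQuarticTorsionCoordinates
  (torsion_coord_isIntegral)

/-- **The addition theorem in normalised coordinates.** For `u, t ∉ Λ = ℤi + ℤ` with `℘(u) ≠ ℘(t)` and `X = ℘/ϖ₀²`, `Y = ℘′/(2ϖ₀³)`: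
`X(u+t) = ((Y_u − Y_t)/(X_u − X_t))² − X_u − X_t` (tree `PeriodPair.weierstrassP_add_holds`). [cite: ArmitageEberlein2001, §7.4.2 Thm 7.2 (7.68)] -/
theorem normalizedX_add {u t : ℂ} (hu : u ∉ (ofUpperHalfPlane UpperHalfPlane.I).lattice)
    (ht : t ∉ (ofUpperHalfPlane UpperHalfPlane.I).lattice)
    (hne : ℘[ofUpperHalfPlane UpperHalfPlane.I] u ≠ ℘[ofUpperHalfPlane UpperHalfPlane.I] t) :
    ℘[ofUpperHalfPlane UpperHalfPlane.I] (u + t) / ((Real.Gamma (1 / 4) ^ 2 / (2 * Real.sqrt (2 * Real.pi)) : ℝ) : ℂ) ^ 2 =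
      ((℘'[ofUpperHalfPlane UpperHalfPlane.I] u / (2 * ((Real.Gamma (1 / 4) ^ 2 / (2 * Real.sqrt (2 * Real.pi)) : ℝ) : ℂ) ^ 3) -
          ℘'[ofUpperHalfPlane UpperHalfPlane.I] t / (2 * ((Real.Gamma (1 / 4) ^ 2 / (2 * Real.sqrt (2 * Real.pi)) : ℝ) : ℂ) ^ 3)) /
        (℘[ofUpperHalfPlane UpperHalfPlane.I] u / ((Real.Gamma (1 / 4) ^ 2 / (2 * Real.sqrt (2 * Real.pi)) : ℝ) : ℂ) ^ 2 -
          ℘[ofUpperHalfPlane UpperHalfPlane.I] t / ((Real.Gamma (1 / 4) ^ 2 / (2 * Real.sqrt (2 * Real.pi)) : ℝ) : ℂ) ^ 2)) ^ 2 -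
      ℘[ofUpperHalfPlane UpperHalfPlane.I] u / ((Real.Gamma (1 / 4) ^ 2 / (2 * Real.sqrt (2 * Real.pi)) : ℝ) : ℂ) ^ 2 -
      ℘[ofUpperHalfPlane UpperHalfPlane.I] t / ((Real.Gamma (1 / 4) ^ 2 / (2 * Real.sqrt (2 * Real.pi)) : ℝ) : ℂ) ^ 2 := by
  set ϖ : ℂ := ((Real.Gamma (1 / 4) ^ 2 / (2 * Real.sqrt (2 * Real.pi)) : ℝ) : ℂ) with hϖ
  have hϖ0 : ϖ ≠ 0 := Complex.ofReal_ne_zero.mpr varpi_pos.ne'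
  have hadd := weierstrassP_add_holds (L := ofUpperHalfPlane UpperHalfPlane.I) u t hu ht hne
  have hsub : ℘[ofUpperHalfPlane UpperHalfPlane.I] u - ℘[ofUpperHalfPlane UpperHalfPlane.I] t ≠ 0 := sub_ne_zero.mpr hne
  rw [hadd]
  field_simp
  ring

/-- **Prime-to-`7` torsion is `7`-integral.** For `w ∉ Λ` with `m′w ∈ Λ`, `7 ∤ m′`, and every valuation `v` of `ℂ` with `v 7 < 1`:
`v(℘(w)/ϖ₀²) ≤ 1` and `v(℘′(w)/(2ϖ₀³)) ≤ 1` (`m′²X`, `m′³Y` are algebraic integers by `torsion_coord_isIntegral`, and `m′` is a `v`-unit).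
[cite: SilvermanAEC2009, VII.3.4] -/
theorem val_normalized_le_one_of_torsion {Γ₀ : Type*} [LinearOrderedCommGroupWithZero Γ₀] (v : Valuation ℂ Γ₀) (h7 : v 7 < 1)
    {w : ℂ} {m : ℕ} (hw : w ∉ (ofUpperHalfPlane UpperHalfPlane.I).lattice)
    (hmw : ((m : ℂ) * w) ∈ (ofUpperHalfPlane UpperHalfPlane.I).lattice) (hm7 : Nat.Coprime m 7) :
    v (℘[ofUpperHalfPlane UpperHalfPlane.I] w / ((Real.Gamma (1 / 4) ^ 2 / (2 * Real.sqrt (2 * Real.pi)) : ℝ) : ℂ) ^ 2) ≤ 1 ∧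
      v (℘'[ofUpperHalfPlane UpperHalfPlane.I] w / (2 * ((Real.Gamma (1 / 4) ^ 2 / (2 * Real.sqrt (2 * Real.pi)) : ℝ) : ℂ) ^ 3)) ≤ 1 := by
  have hm0 : m ≠ 0 := by
    rintro rfl
    apply hw
    simp only [Nat.cast_zero, zero_mul] at hmw
    -- `0 ∈ Λ` does not give `w ∈ Λ`; instead `Nat.Coprime 0 7` is false
    exact absurd hm7 (by decide)
  obtain ⟨hX, hY⟩ := torsion_coord_isIntegral hw hmw hm0
  have hvm : v (m : ℂ) = 1 := val_natCast_eq_one_of_coprime_seven v h7 hm7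
  have hX' := val_le_one_of_isIntegral v hX
  have hY' := val_le_one_of_isIntegral v hY
  rw [Valuation.map_mul, Valuation.map_pow, hvm, one_pow, one_mul] at hX' hY'
  exact ⟨hX', hY'⟩

/-- ★ **The chord `P_w + Q_t` is `7`-integral and congruent to `P_w`.** For `w ∉ Λ` of order `m′` prime to `7` (`m′w ∈ Λ`), a
`7`-division point `t` (`t ∉ Λ`, `7t ∈ Λ`) and EVERY valuation `v` of `ℂ` with `v 7 < 1`, in the normalised coordinates `X = ℘/ϖ₀²`,
`Y = ℘′/(2ϖ₀³)` of `y² = x³ − x`: `v(X(w+t) − X(w)) < 1`, `v(X(w+t)) ≤ 1` and `v(Y(w+t)) ≤ 1`. (`X(t)` has order `−1/24` by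
`…SevenDivisionEisenstein.val_weierstrassP_seven_div`, `X(w), Y(w)` are integral, then `chord_formal` on `y² = x³ − x` and the addition
theorem; `Y(w+t)² = X(w+t)³ − X(w+t)`.) [cite: SilvermanAEC2009, III.2.3 and VII.2] [cite: ArmitageEberlein2001, §7.4.2 Thm 7.2 (7.68)] -/
theorem val_normalizedX_add_seven_div {Γ₀ : Type*} [LinearOrderedCommGroupWithZero Γ₀] (v : Valuation ℂ Γ₀) (h7 : v 7 < 1)
    {w t : ℂ} {m : ℕ} (hw : w ∉ (ofUpperHalfPlane UpperHalfPlane.I).lattice)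
    (hmw : ((m : ℂ) * w) ∈ (ofUpperHalfPlane UpperHalfPlane.I).lattice) (hm7 : Nat.Coprime m 7)
    (ht : t ∉ (ofUpperHalfPlane UpperHalfPlane.I).lattice) (h7t : (7 : ℂ) * t ∈ (ofUpperHalfPlane UpperHalfPlane.I).lattice)
    (hwt : w + t ∉ (ofUpperHalfPlane UpperHalfPlane.I).lattice) :
    v (℘[ofUpperHalfPlane UpperHalfPlane.I] (w + t) / ((Real.Gamma (1 / 4) ^ 2 / (2 * Real.sqrt (2 * Real.pi)) : ℝ) : ℂ) ^ 2 -
        ℘[ofUpperHalfPlane UpperHalfPlane.I] w / ((Real.Gamma (1 / 4) ^ 2 / (2 * Real.sqrt (2 * Real.pi)) : ℝ) : ℂ) ^ 2) < 1 ∧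
    v (℘[ofUpperHalfPlane UpperHalfPlane.I] (w + t) / ((Real.Gamma (1 / 4) ^ 2 / (2 * Real.sqrt (2 * Real.pi)) : ℝ) : ℂ) ^ 2) ≤ 1 ∧
    v (℘'[ofUpperHalfPlane UpperHalfPlane.I] (w + t) / (2 * ((Real.Gamma (1 / 4) ^ 2 / (2 * Real.sqrt (2 * Real.pi)) : ℝ) : ℂ) ^ 3)) ≤ 1 := by
  -- integrality of `P_w`, non-integrality of `Q_t` (facts first, then name the coordinates)
  obtain ⟨hXP, hYP⟩ := val_normalized_le_one_of_torsion v h7 hw hmw hm7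
  obtain ⟨hXQ0, -, hvXQ, -⟩ := val_weierstrassP_seven_div v h7 ht h7t
  obtain ⟨-, hQcurve⟩ :=
    Summit.BirchSwinnertonDyer.BirchSwinnertonDyer.Theorems.BiquadraticEisensteinDescentManinDatumSupercuspidalCMInertSevenDivisionEisenstein.psi_seven_weierstrassP_div
      ht h7t
  have hadd0 := fun hne ↦ normalizedX_add hw ht hne
  set ϖ : ℂ := ((Real.Gamma (1 / 4) ^ 2 / (2 * Real.sqrt (2 * Real.pi)) : ℝ) : ℂ) with hϖ
  have hϖ0 : ϖ ≠ 0 := Complex.ofReal_ne_zero.mpr varpi_pos.ne'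
  set XP : ℂ := ℘[ofUpperHalfPlane UpperHalfPlane.I] w / ϖ ^ 2 with hXPdef
  set YP : ℂ := ℘'[ofUpperHalfPlane UpperHalfPlane.I] w / (2 * ϖ ^ 3) with hYPdef
  set XQ : ℂ := ℘[ofUpperHalfPlane UpperHalfPlane.I] t / ϖ ^ 2 with hXQdef
  set YQ : ℂ := ℘'[ofUpperHalfPlane UpperHalfPlane.I] t / (2 * ϖ ^ 3) with hYQdef
  have hvXQpos : 0 < v XQ := lt_of_le_of_ne zero_le (Ne.symm ((Valuation.ne_zero_iff v).mpr hXQ0))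
  have hq : 1 < v XQ := by
    by_contra hle
    push Not at hle
    have h1 : 1 ≤ v XQ⁻¹ := by
      rw [map_inv₀]; exact (one_le_inv₀ hvXQpos).mpr hle
    have : (1 : Γ₀) ≤ v XQ⁻¹ ^ 24 := one_le_pow₀ h1
    rw [hvXQ] at this
    exact absurd h7 (not_lt.mpr this)
  -- `℘ w ≠ ℘ t` since `v XP ≤ 1 < v XQ`
  have hne : ℘[ofUpperHalfPlane UpperHalfPlane.I] w ≠ ℘[ofUpperHalfPlane UpperHalfPlane.I] t := by
    intro h
    have hXPQ : XP = XQ := by rw [hXPdef, hXQdef, h]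
    have hXP' : v XQ ≤ 1 := by rw [← hXPQ]; exact hXP
    exact absurd hq (not_lt.mpr hXP')
  -- the chord on `y² = x³ − x` (`A = −1`, `B = 0`)
  have hQ' : YQ ^ 2 = XQ ^ 3 + (-1) * XQ + 0 := by rw [hQcurve]; ring
  have hA : v (-1 : ℂ) ≤ 1 := by rw [Valuation.map_neg, Valuation.map_one]
  have hB : v (0 : ℂ) ≤ 1 := by rw [Valuation.map_zero]; exact zero_le
  obtain ⟨hchord, -⟩ := chord_formal v hA hB hXP hYP hQ' hq
  have hadd : ℘[ofUpperHalfPlane UpperHalfPlane.I] (w + t) / ϖ ^ 2 = ((YP - YQ) / (XP - XQ)) ^ 2 - XP - XQ :=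
    hadd0 hne
  have hsymm : ((YP - YQ) / (XP - XQ)) ^ 2 = ((YQ - YP) / (XQ - XP)) ^ 2 := by
    rw [← neg_sub YQ YP, ← neg_sub XQ XP, neg_div_neg_eq]
  have h1 : v (℘[ofUpperHalfPlane UpperHalfPlane.I] (w + t) / ϖ ^ 2 - XP) < 1 := by
    rw [hadd, hsymm]
    exact hchord
  have h2 : v (℘[ofUpperHalfPlane UpperHalfPlane.I] (w + t) / ϖ ^ 2) ≤ 1 := by
    have : ℘[ofUpperHalfPlane UpperHalfPlane.I] (w + t) / ϖ ^ 2 = (℘[ofUpperHalfPlane UpperHalfPlane.I] (w + t) / ϖ ^ 2 - XP) + XP := by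
      ring
    rw [this]
    exact Valuation.map_add_le v h1.le hXP
  refine ⟨h1, h2, ?_⟩
  -- `Y(w+t)² = X(w+t)³ − X(w+t)`
  have hQ2 := (ofUpperHalfPlane UpperHalfPlane.I).derivWeierstrassP_sq (w + t) hwt
  rw [g₂_eq_varpi', g₃_ofUpperHalfPlane_I, sub_zero, ← hϖ] at hQ2
  have hY2 : (℘'[ofUpperHalfPlane UpperHalfPlane.I] (w + t) / (2 * ϖ ^ 3)) ^ 2 =
      (℘[ofUpperHalfPlane UpperHalfPlane.I] (w + t) / ϖ ^ 2) ^ 3 - ℘[ofUpperHalfPlane UpperHalfPlane.I] (w + t) / ϖ ^ 2 := by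
    field_simp
    linear_combination hQ2
  have hv2 : v (℘'[ofUpperHalfPlane UpperHalfPlane.I] (w + t) / (2 * ϖ ^ 3)) ^ 2 ≤ 1 := by
    rw [← Valuation.map_pow, hY2]
    refine Valuation.map_sub_le v ?_ h2
    rw [Valuation.map_pow]; exact pow_le_one₀ zero_le h2
  by_contra hgt
  push Not at hgt
  exact absurd hv2 (not_le.mpr (one_lt_pow₀ hgt two_ne_zero))

end Analytic

end Summit.BirchSwinnertonDyer.BirchSwinnertonDyer.Theorems.BiquadraticEisensteinDescentManinDatumSupercuspidalCMInertFormalChord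

end
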